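import Mathlib
import Summits.NavierStokesRegularity.NavierStokesRegularity.Theorems.DssFarFieldSlavingBlowupTypeIDssProfileSimilarityEnstrophyMixedCore
import Literature.Analysis.FluidPDE.TypeIAncientMildDecay
import HarnessLib

/-!
# E3′ / T47 (Tier 1): the MIXED-CONSTANT / ENVELOPE threshold — classical (unconditional), at CLASS
  level, and the mixed-constant portrait floor (pub-ns-dss theory ENVELOPE-FLOOR.md v1.1
  7d4ff1ae9522137b «candidate T47», Tier 1 = tree tools only, lead A422 (b); route
  `DssFarFieldSlaving`, crux `BlowupTypeIDssProfile`, stmt-NavierStokesRegularity-0155 — SUPPORT;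
  typer seat g9, 2026-08-24)

HONEST FRAMING. Exclusion statements about a HYPOTHETICAL object (a Type-I ancient mild solution in
the KNSS gauge / a member of the rotated-DSS Type-I class), in the currency of the scale-invariant
MIXED constant `P`: `‖x‖·√(−t)·‖V(t,x)‖² ≤ P` (geometric mean of the time-only constant
`M_t = sup √(−t)‖V‖` and the space-only constant `A_sp = sup ‖x‖‖V‖`: `P ≤ M_t·A_sp`; `P ≤ C₀²/4`
under the envelope `HasTypeIDecay C₀ V`). CLASSICAL: `P² < 16/27` (`P < 4/(3√3) ≈ 0.7698`) ⇒
`V ≡ 0` at ANY Type-I level — GIVEN (D) (`…_of_decay`) and UNCONDITIONALLY (the decay input (D) is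
the tree's Literature theorem `IsTypeIAncientMild.gaugeBounds_of_hasTypeIDecay`); ENVELOPE:
`C₀⁴ < 256/27` ⇒ `V ≡ 0`; CLASS: the hypothesis class of `RdssProfileTruncation` (any `c > 1`, ANY
twist `R ∈ O(3)`) at space–time Type-I level `M` is EMPTY for every `M⁴ < 256/27`
(`M < (256/27)^{1/4} ≈ 1.7548`; decimal surrogate `M ≤ 7/4`) — the VERBATIM class shape of
`SimilarityEnstrophy.rdssClass_empty_of_typeI_lt_one` (every `M < 1`, p366221, which stays the
discharge's), containing it; PORTRAIT (∀-representative shape of `rdssClass_empty_of_spaceConstant`):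
at every level `M` no non-trivial member has all its smooth KNSS representatives with `P² < 16/27`
(the two-constant hyperbola is NOT stated at Tier 1: with the Tier-1 constant it is implied by Rows
2′/4/5 jointly, lead A422 (b); it belongs to Tier 2). MECHANISM: the UNWEIGHTED similarity
enstrophy `Z = ∫‖Ω‖²` — by the core (`…SimilarityEnstrophyMixedCore.lean`)
`Str ≤ (2/3)D + (3P/8)∫‖Ω‖²/‖y‖` and `∫‖Ω‖²/‖y‖ ≤ 2μD + Z/(2μ)` (Hardy ∘ Young, `μ = 4/(9P)`),
so `Str ≤ D + (27P²/64)Z` and the budget `½Z′ = −D − ¼Z + Str` closes at rate `½ − 27P²/32`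
(`typeI_ancient_eq_zero_of_stretching_le`). TIER 1 of the theory note; the Coulomb-uncertainty route
(a factor 2 better: `2.48`, hyperbola) is NOT typed here. METHOD constants (Hardy's `4`, Young); no
sharpness claimed; nothing for larger `M`. DSS-BLIND: the class proofs discard `c`, `R`,
`IsRotatedDSS`. Derivation: theory seat (ENVELOPE-FLOOR.md §3, DERIVED — combination of printed
steps; red ×2 requested 2026-08-24). PRINTED CONTEXT (theory's presearch; comparators only): KNSS
2009 / Seregin 2014 (bounded ancient mild ⇒ constant, open in 3D); nothing is quoted from print.
Census words on ACCEPT, if any, are the lead's (pre-stated A422 (3)). Nothing numeric about any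
candidate; nothing here bears on Navier–Stokes regularity or blow-up.
-/

noncomputable section

set_option linter.dupNamespace false

namespace Summit.NavierStokesRegularity.NavierStokesRegularity.Theorems.SimilarityEnstrophy

open MeasureTheory Set Filter Topology Module Metric InnerProductSpace Function
open scoped RealInnerProductSpace Laplacian ContDiff ENNReal
open Literature.Analysis Literature.Analysis.FluidPDE Literature.Analysis.Calculus
open Summit.NavierStokesRegularity.NavierStokesRegularity.Theorems.GaussianGap
open Summit.NavierStokesRegularity.NavierStokesRegularity.Theorems.PlanarEnergyAPriori

variable {M : ℝ} {V : ℝ → EuclideanSpace ℝ (Fin 3) → EuclideanSpace ℝ (Fin 3)}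

/-- **The stretching bound from the MIXED constant, Tier 1** (theory ENVELOPE-FLOOR §3):
`Str(s) ≤ ∫|∇Ω(s)|²_F + (27P²/64) Z(s)` — `integral_stretching_le_dissipation_add_mixedWeight` plus
the Hardy-based weight bound `∫‖Ω‖²/‖y‖ ≤ 2μD + Z/(2μ)` with `μ = 4/(9P)` (`P = 0` separately).
[this file; theory T47 Tier 1] -/
theorem integral_stretching_le_of_mixedConstant (hV : IsTypeIAncientMild M V) {C₁ C₂ : ℝ}
    (hD1 : ∀ t < 0, ∀ x, (‖x‖ + Real.sqrt (-t)) ^ (1 + 1) * ‖iteratedFDeriv ℝ 1 (V t) x‖ ≤ C₁)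
    (hD2 : ∀ t < 0, ∀ x, (‖x‖ + Real.sqrt (-t)) ^ (2 + 1) * ‖iteratedFDeriv ℝ 2 (V t) x‖ ≤ C₂)
    {P : ℝ} (hP : ∀ t < 0, ∀ x, ‖x‖ * Real.sqrt (-t) * ‖V t x‖ ^ 2 ≤ P) (s : ℝ) :
    ∫ y, ⟪lerayVorticity V s y, fderiv ℝ (lerayOrbit V s) y (lerayVorticity V s y)⟫ ≤
      (∫ y, frobeniusNormSq (fderiv ℝ (lerayVorticity V s) y)) +
        (27 * P ^ 2 / 64) * ∫ y, ‖lerayVorticity V s y‖ ^ 2 := by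
  have h1 := integral_stretching_le_dissipation_add_mixedWeight hV hD1 hD2 hP s
  have hP0 : 0 ≤ P := mixedConstant_nonneg hP
  set D : ℝ := ∫ y, frobeniusNormSq (fderiv ℝ (lerayVorticity V s) y) with hD
  set Z : ℝ := ∫ y, ‖lerayVorticity V s y‖ ^ 2 with hZ
  set X : ℝ := ∫ y, ‖lerayVorticity V s y‖ ^ 2 / ‖y‖ with hX
  have hD0 : 0 ≤ D := integral_nonneg fun y => frobeniusNormSq_nonneg _
  -- the intermediate weight: `(3P/8) X ≤ D/3 + (27P²/64) Z`
  have hmid : 3 * P / 8 * X ≤ 1 / 3 * D + 27 * P ^ 2 / 64 * Z := by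
    rcases hP0.eq_or_lt with hP00 | hPpos
    · rw [← hP00]
      have : (0 : ℝ) ≤ 1 / 3 * D := by linarith
      simpa using this
    · have hμ : 0 < 4 / (9 * P) := by positivity
      have hXb := (integral_norm_sq_div_norm_le_of_hardy hV hD1 hD2 s hμ).2
      have e : 3 * P / 8 * (2 * (4 / (9 * P)) * D + 1 / (2 * (4 / (9 * P))) * Z) =
          1 / 3 * D + 27 * P ^ 2 / 64 * Z := by
        field_simp
        ring
      calc 3 * P / 8 * X ≤ 3 * P / 8 * (2 * (4 / (9 * P)) * D + 1 / (2 * (4 / (9 * P))) * Z) :=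
            mul_le_mul_of_nonneg_left hXb (by positivity)
        _ = 1 / 3 * D + 27 * P ^ 2 / 64 * Z := e
  linarith

/-- **T47 under (D), CLASSICAL level** (theory ENVELOPE-FLOOR, Tier 1). Let `V` be a KNSS-gauge
Type-I field (`IsTypeIAncientMild M V`, ANY `M`) with mixed constant `P`, `P² < 16/27`
(`‖x‖·√(−t)·‖V(t,x)‖² ≤ P`), and the scale-invariant gauge bounds (D) of orders `1, 2, 3`. Then
`V ≡ 0` on `t < 0` (`Str ≤ D + (27P²/64)Z` with `27P²/64 < ¼`, `typeI_ancient_eq_zero_of_stretching_le`;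
rate `½ − 27P²/32`). [this file; theory T47 (DERIVED); here a tree theorem GIVEN (D); unconditional
form: `typeI_ancient_eq_zero_of_mixedConstant`] -/
theorem typeI_ancient_eq_zero_of_mixedConstant_of_decay (hV : IsTypeIAncientMild M V) {P : ℝ}
    (hP : ∀ t < 0, ∀ x, ‖x‖ * Real.sqrt (-t) * ‖V t x‖ ^ 2 ≤ P) (hPlt : P ^ 2 < 16 / 27)
    {C₁ C₂ C₃ : ℝ}
    (hD1 : ∀ t < 0, ∀ x, (‖x‖ + Real.sqrt (-t)) ^ (1 + 1) * ‖iteratedFDeriv ℝ 1 (V t) x‖ ≤ C₁)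
    (hD2 : ∀ t < 0, ∀ x, (‖x‖ + Real.sqrt (-t)) ^ (2 + 1) * ‖iteratedFDeriv ℝ 2 (V t) x‖ ≤ C₂)
    (hD3 : ∀ t < 0, ∀ x, (‖x‖ + Real.sqrt (-t)) ^ (3 + 1) * ‖iteratedFDeriv ℝ 3 (V t) x‖ ≤ C₃) :
    ∀ t < 0, ∀ x, V t x = 0 :=
  typeI_ancient_eq_zero_of_stretching_le hV hD1 hD2 hD3 (β := 27 * P ^ 2 / 64) (by nlinarith)
    fun s => integral_stretching_le_of_mixedConstant hV hD1 hD2 hP s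

/-- **T47, CLASSICAL level, UNCONDITIONAL** (theory ENVELOPE-FLOOR, Tier 1: «P < 4/(3√3) ⇒ V ≡ 0»):
a KNSS-gauge Type-I field `V` (`IsTypeIAncientMild M V`, any `M`) with the space–time envelope
`HasTypeIDecay C₀ V` (any `C₀`) and mixed constant `P² < 16/27` vanishes on `t < 0`. The decay (D)
is supplied by the tree's Literature theorem `IsTypeIAncientMild.gaugeBounds_of_hasTypeIDecay` at
the level `max M C₀` (`isTypeIAncientMild_mono`). NO named input. [this file; theory T47 Tier 1;
nothing here bears on NS regularity] -/
theorem typeI_ancient_eq_zero_of_mixedConstant (hV : IsTypeIAncientMild M V) {C₀ : ℝ}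
    (hdec : HasTypeIDecay C₀ V) {P : ℝ}
    (hP : ∀ t < 0, ∀ x, ‖x‖ * Real.sqrt (-t) * ‖V t x‖ ^ 2 ≤ P) (hPlt : P ^ 2 < 16 / 27) :
    ∀ t < 0, ∀ x, V t x = 0 := by
  have hV' : IsTypeIAncientMild (max M C₀) V := isTypeIAncientMild_mono hV (le_max_left _ _)
  have hdec' : HasTypeIDecay (max M C₀) V := fun t ht x =>
    (hdec t ht x).trans (div_le_div_of_nonneg_right (le_max_right _ _) (by positivity))
  obtain ⟨C₁, C₂, C₃, hD1, hD2, hD3⟩ := IsTypeIAncientMild.gaugeBounds_of_hasTypeIDecay hV' hdec'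
  exact typeI_ancient_eq_zero_of_mixedConstant_of_decay hV' hP hPlt hD1 hD2 hD3

/-- **T47-E (envelope currency), CLASSICAL, UNCONDITIONAL** (theory ENVELOPE-FLOOR, Tier 1): a
KNSS-gauge Type-I field with `HasTypeIDecay C₀ V` and `C₀⁴ < 256/27` (`C₀ < (256/27)^{1/4} ≈ 1.7548`)
vanishes on `t < 0` (`P ≤ C₀²/4`, `(C₀²/4)² < 16/27`). [this file; theory T47-E Tier 1] -/
theorem typeI_ancient_eq_zero_of_hasTypeIDecay_pow_four_lt (hV : IsTypeIAncientMild M V) {C₀ : ℝ}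
    (hdec : HasTypeIDecay C₀ V) (hC : C₀ ^ 4 < 256 / 27) : ∀ t < 0, ∀ x, V t x = 0 :=
  typeI_ancient_eq_zero_of_mixedConstant hV hdec (mixedConstant_le_of_hasTypeIDecay hdec)
    (by nlinarith)

/-- **E3′-ENV at CLASS level, UNCONDITIONAL** (theory ENVELOPE-FLOOR, Tier 1): the hypothesis class of
`RdssProfileTruncation` (any `c > 1`, ANY twist `R ∈ O(3)`) at space–time Type-I level `M` is EMPTY
for every `M⁴ < 256/27` (`M < (256/27)^{1/4} ≈ 1.7548`) — the VERBATIM class shape of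
`rdssClass_empty_of_typeI_lt_one` (every `M < 1`), which it contains. Proof: the smooth KNSS
representative (`typeI_ancient_smoothRepresentative_ae`) carries `HasTypeIDecay M V` and vanishes by
`typeI_ancient_eq_zero_of_hasTypeIDecay_pow_four_lt`. DSS-blind; a METHOD threshold, no sharpness
claimed. [this file; theory E3′-ENV Tier 1; census words on ACCEPT, if any, are the lead's; nothing
here bears on NS regularity] -/
theorem rdssClass_empty_of_typeI_pow_four_lt {M : ℝ} (hM : M ^ 4 < 256 / 27) :
    ¬ ∃ (c : ℝ) (R : (EuclideanSpace ℝ (Fin 3)) ≃ₗᵢ[ℝ] (EuclideanSpace ℝ (Fin 3)))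
        (u : ℝ → (EuclideanSpace ℝ (Fin 3)) → (EuclideanSpace ℝ (Fin 3))),
      1 < c ∧ IsAncientMildSolution 1 u ∧ (∀ t < 0, AEStronglyMeasurable (u t) volume) ∧
      IsRotatedDSS c R u ∧ HasTypeIDecay M u ∧ ¬ (∀ t < 0, u t =ᵐ[volume] 0) := by
  rintro ⟨c, R, u, -, hmild, hmeas, -, hdec, hne⟩
  obtain ⟨V, hT, hdecV, hVu, -⟩ := typeI_ancient_smoothRepresentative_ae hmild hmeas hdec
  have hz : ∀ t < 0, ∀ x, V t x = 0 :=
    typeI_ancient_eq_zero_of_hasTypeIDecay_pow_four_lt hT hdecV hM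
  refine hne fun t ht => ?_
  have hVz : V t = 0 := funext fun x => by simpa using hz t ht x
  exact (hVu t ht).symm.trans (Filter.EventuallyEq.of_eq hVz)

/-- **E3′-ENV, decimal surrogate**: the class at level `M` is empty for every `M ≤ 7/4`
(`(7/4)⁴ = 2401/256 < 256/27`; for `M < 0` the hypothesis `HasTypeIDecay M u` is already
contradictory at `(t,x) = (−1,0)`). [this file] -/
theorem rdssClass_empty_of_typeI_le_seven_quarters {M : ℝ} (hM : M ≤ 7 / 4) :
    ¬ ∃ (c : ℝ) (R : (EuclideanSpace ℝ (Fin 3)) ≃ₗᵢ[ℝ] (EuclideanSpace ℝ (Fin 3)))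
        (u : ℝ → (EuclideanSpace ℝ (Fin 3)) → (EuclideanSpace ℝ (Fin 3))),
      1 < c ∧ IsAncientMildSolution 1 u ∧ (∀ t < 0, AEStronglyMeasurable (u t) volume) ∧
      IsRotatedDSS c R u ∧ HasTypeIDecay M u ∧ ¬ (∀ t < 0, u t =ᵐ[volume] 0) := by
  rcases lt_or_ge M 0 with hneg | hnn
  · rintro ⟨c, R, u, -, -, -, -, hdec, -⟩
    have h0 : 0 ≤ M := by simpa using (norm_nonneg _).trans (hdec (-1) (by norm_num) 0)
    exact absurd h0 (not_le.2 hneg)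
  · refine rdssClass_empty_of_typeI_pow_four_lt ?_
    have h2 : M ^ 2 ≤ (7 / 4) ^ 2 := pow_le_pow_left₀ hnn hM 2
    nlinarith

/-- **The mixed-constant PORTRAIT FLOOR at CLASS level, UNCONDITIONAL** (theory ENVELOPE-FLOOR
«PORTRAIT», ∀-representative shape of `rdssClass_empty_of_spaceConstant`): at EVERY space–time
Type-I level `M`, no non-trivial member of the hypothesis class of `RdssProfileTruncation` (any
`c > 1`, ANY twist `R ∈ O(3)`) has all its smooth KNSS representatives (`IsTypeIAncientMild M V`,
`V(t) = u(t)` a.e.) obeying `‖x‖·√(−t)·‖V(t,x)‖² ≤ P` with `P² < 16/27` — every survivor has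
mixed constant `P ≥ 4/(3√3)`. DSS-blind. [this file; theory T47 portrait; census words on ACCEPT,
if any, are the lead's; nothing numerical is asserted and nothing here bears on NS regularity] -/
theorem rdssClass_empty_of_mixedConstant (M : ℝ) {P : ℝ} (hPlt : P ^ 2 < 16 / 27) :
    ¬ ∃ (c : ℝ) (R : (EuclideanSpace ℝ (Fin 3)) ≃ₗᵢ[ℝ] (EuclideanSpace ℝ (Fin 3)))
        (u : ℝ → (EuclideanSpace ℝ (Fin 3)) → (EuclideanSpace ℝ (Fin 3))),
      1 < c ∧ IsAncientMildSolution 1 u ∧ (∀ t < 0, AEStronglyMeasurable (u t) volume) ∧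
      IsRotatedDSS c R u ∧ HasTypeIDecay M u ∧
      (∀ V : ℝ → EuclideanSpace ℝ (Fin 3) → EuclideanSpace ℝ (Fin 3), IsTypeIAncientMild M V →
        (∀ t < 0, V t =ᵐ[volume] u t) →
        ∀ t < 0, ∀ x, ‖x‖ * Real.sqrt (-t) * ‖V t x‖ ^ 2 ≤ P) ∧
      ¬ (∀ t < 0, u t =ᵐ[volume] 0) := by
  rintro ⟨c, R, u, -, hmild, hmeas, -, hdec, hrep, hne⟩
  obtain ⟨V, hT, hdecV, hVu, -⟩ := typeI_ancient_smoothRepresentative_ae hmild hmeas hdec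
  have hz : ∀ t < 0, ∀ x, V t x = 0 :=
    typeI_ancient_eq_zero_of_mixedConstant hT hdecV (hrep V hT hVu) hPlt
  refine hne fun t ht => ?_
  have hVz : V t = 0 := funext fun x => by simpa using hz t ht x
  exact (hVu t ht).symm.trans (Filter.EventuallyEq.of_eq hVz)

end Summit.NavierStokesRegularity.NavierStokesRegularity.Theorems.SimilarityEnstrophy
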